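import Mathlib
import Summits.ValiantsHypothesis.ValiantsHypothesis.Theorems.DivisionGapPerMultiplesHardStubRegularPairCleanAux

/-!
# `DivisionGap.PerMultiplesHard` (stmt-ValiantsHypothesis-5068), line `uncharged-face-walk`:
stub `stub_regularPairClean` — cleaning a dense regular pair (lead c9, cycle 9)

Given a balanced dense `1/P`-regular pair `(V, W)` (`#V = #W = m ≥ 16`, density
`p = e(V,W)/m² ≥ 1/Dd`, `P ≥ 2048·Dd²·E`) of a bipartite graph `X ⊆ Fin N × Fin N`, we produce
`A ⊆ V`, `B ⊆ W` of size `a = m/8` with (h1) all row/column degrees `≥ a/(4Dd)`, (h3) for every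
row `x ∈ A` at most `a/E` rows `x' ∈ A` of codegree `< a/(64Dd²)` inside `B`, (pm) an injective
`g` matching `A` into `B` along `X`-edges, (dens) `a² ≤ 2Dd·e(A,B)` and (reg) `1/(P/16)`-regularity
of `(A, B)` for its own density.

ROUTE (all "few exceptions" steps are single applications of regularity, see the Aux file
`DivisionGapPerMultiplesHardStubRegularPairCleanAux`): `stub_regularPairClean_sets` gives `A`, `B₀`, `B`
with row degrees into `B₀` and column degrees from `B` at least `(p - 1/P)a`, `B ⊇ B₀ ∖ Bad`,
`P·#Bad < m ≤ 16a`; the parameter bookkeeping `numerics` (`1/(2Dd) + 17/P ≤ p`,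
`1/(64Dd²) + 16/P ≤ (p - 1/P)²`, `32Dd ≤ P`) turns this into row degrees `≥ a/(2Dd)` into `B`,
the codegree count `codegree_few` ((h3): rows with few neighbours in `N_{B₀}(x)` are few by
`few_lowRows`, all others have codegree `≥ (p-1/P)²a - #Bad ≥ a/(64Dd²)` in `B`), the Hall clause
of `exists_matching` (a row set `U` with `#U > a/(2Dd)` has `P #U ≥ m`, so the columns missing it
are `< m/P ≤ a/(2Dd)` by `few_lowCols`), the density bound `sq_le_of_min_degree`, and
`regularity_transfer`. [folklore]
-/

noncomputable section

-- `Summit.ValiantsHypothesis.ValiantsHypothesis.…` is the tree's mandated layout (Sub = Summit).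
set_option linter.dupNamespace false

open Finset
open scoped BigOperators

namespace Summit.ValiantsHypothesis.ValiantsHypothesis.Theorems.DivisionGap.PerMultiplesHard.RegularPairClean

open Summit.ValiantsHypothesis.ValiantsHypothesis.Theorems.DivisionGap.PerMultiplesHard.RegularPairCleanAux

variable {N : ℕ}

/-- PARAMETER BOOKKEEPING.  For `Dd, E ≥ 1`, `P ≥ 2048 Dd² E` and `p ≥ 1/Dd`:
`1/(2Dd) + 17/P ≤ p`, `1/(64Dd²) + 16/P ≤ (p - 1/P)²` and `32 Dd ≤ P`. [folklore] -/
theorem numerics {Dd E P : ℕ} {p : ℝ} (hDd : 1 ≤ Dd) (hE : 1 ≤ E) (hP : 2048 * Dd ^ 2 * E ≤ P)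
    (hp : 1 / (Dd : ℝ) ≤ p) :
    1 / (2 * (Dd : ℝ)) + 17 * (1 / (P : ℝ)) ≤ p ∧
      1 / (64 * (Dd : ℝ) ^ 2) + 16 * (1 / (P : ℝ)) ≤ (p - 1 / (P : ℝ)) * (p - 1 / (P : ℝ)) ∧
      32 * (Dd : ℝ) ≤ P := by
  have hD1 : (1 : ℝ) ≤ Dd := by exact_mod_cast hDd
  have hPD : (2048 : ℝ) * Dd ^ 2 ≤ P := by
    exact_mod_cast le_trans (Nat.le_mul_of_pos_right _ hE) hP
  have hDpos : (0 : ℝ) < Dd := by linarith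
  have hu : 1 / (P : ℝ) ≤ 1 / (Dd : ℝ) * (1 / (Dd : ℝ)) / 2048 :=
    calc 1 / (P : ℝ) ≤ 1 / (2048 * (Dd : ℝ) ^ 2) :=
          one_div_le_one_div_of_le (mul_pos (by norm_num) (pow_pos hDpos 2)) hPD
      _ = 1 / (Dd : ℝ) * (1 / (Dd : ℝ)) / 2048 := by ring
  have hu1 : 1 / (Dd : ℝ) ≤ 1 := by rw [div_le_one hDpos]; exact hD1
  have hu0 : 0 < 1 / (Dd : ℝ) := div_pos one_pos hDpos
  have huu : 1 / (Dd : ℝ) * (1 / (Dd : ℝ)) ≤ 1 / (Dd : ℝ) := mul_le_of_le_one_right hu0.le hu1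
  have huu0 : 0 < 1 / (Dd : ℝ) * (1 / (Dd : ℝ)) := mul_pos hu0 hu0
  have h2D : 1 / (2 * (Dd : ℝ)) = 1 / (Dd : ℝ) / 2 := by ring
  have h64 : 1 / (64 * (Dd : ℝ) ^ 2) = 1 / (Dd : ℝ) * (1 / (Dd : ℝ)) / 64 := by ring
  refine ⟨by rw [h2D]; linarith, ?_, ?_⟩
  · have h1 : 1 / (Dd : ℝ) / 2 ≤ p - 1 / (P : ℝ) := by linarith
    have h2 : 1 / (Dd : ℝ) / 2 * (1 / (Dd : ℝ) / 2) ≤ (p - 1 / (P : ℝ)) * (p - 1 / (P : ℝ)) :=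
      mul_self_le_mul_self (by positivity) h1
    rw [h64]
    linarith
  · nlinarith [mul_le_mul_of_nonneg_left hD1 hDpos.le]

/-- From the real bound `a/(2Dd) ≤ c` to the natural-number bound `a ≤ 4 Dd c`. [folklore] -/
theorem le_four_mul_of_half_bound {Dd a c : ℕ} (hDd : 1 ≤ Dd)
    (h : 1 / (2 * (Dd : ℝ)) * a ≤ (c : ℝ)) : a ≤ 4 * Dd * c := by
  have hD : (1 : ℝ) ≤ Dd := by exact_mod_cast hDd
  have h1 : (a : ℝ) ≤ 2 * Dd * c := by
    have := mul_le_mul_of_nonneg_left h (by positivity : (0 : ℝ) ≤ 2 * Dd)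
    rwa [← mul_assoc, mul_one_div_cancel (ne_of_gt (by linarith)), one_mul] at this
  have h2 : (a : ℝ) ≤ 4 * Dd * c := by nlinarith [(Nat.cast_nonneg c : (0 : ℝ) ≤ c)]
  exact_mod_cast h2

/-- (dens): `a² ≤ 2 Dd · e(A,B)` from `#A = a` and the minimum row degree `a/(2Dd)` into `B`
(sum the row degrees, `edges_eq_sum_rows`). [folklore] -/
theorem sq_le_of_min_degree {Dd a : ℕ} {X : Finset (Fin N × Fin N)} {A B : Finset (Fin N)}
    (hDd : 1 ≤ Dd) (hA : A.card = a)
    (hrow : ∀ x ∈ A, 1 / (2 * (Dd : ℝ)) * a ≤ ((B.filter fun y => (x, y) ∈ X).card : ℝ)) :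
    a * a ≤ 2 * Dd * (X.filter fun e => e.1 ∈ A ∧ e.2 ∈ B).card := by
  have hD : (1 : ℝ) ≤ Dd := by exact_mod_cast hDd
  have h1 : (a : ℝ) * (1 / (2 * (Dd : ℝ)) * a) ≤
      (((X.filter fun e => e.1 ∈ A ∧ e.2 ∈ B).card : ℕ) : ℝ) := by
    rw [edges_eq_sum_rows, Nat.cast_sum]
    calc (a : ℝ) * (1 / (2 * (Dd : ℝ)) * a) = ∑ _x ∈ A, 1 / (2 * (Dd : ℝ)) * a := by
          rw [sum_const, hA, nsmul_eq_mul]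
      _ ≤ _ := sum_le_sum hrow
  have h2 : (a : ℝ) * a ≤ 2 * Dd * (X.filter fun e => e.1 ∈ A ∧ e.2 ∈ B).card := by
    have h3 := mul_le_mul_of_nonneg_left h1 (by positivity : (0 : ℝ) ≤ 2 * Dd)
    have h4 : 2 * (Dd : ℝ) * (1 / (2 * Dd)) = 1 := mul_one_div_cancel (ne_of_gt (by linarith))
    have h5 : 2 * (Dd : ℝ) * (a * (1 / (2 * Dd) * a)) = a * a := by
      calc 2 * (Dd : ℝ) * (a * (1 / (2 * Dd) * a)) = 2 * (Dd : ℝ) * (1 / (2 * Dd)) * (a * a) := by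
            ring
        _ = a * a := by rw [h4, one_mul]
    linarith
  exact_mod_cast h2

/-- (h3): FEW LOW-CODEGREE PARTNERS.  With `Y := N_{B₀}(x)` (`#Y ≥ (p - 1/P) a`, `P #Y ≥ m`), the
rows `x' ∈ A` with `deg_Y x' < (p - 1/P) #Y` number `< m/P` (`few_lowRows`); every other row has
`codeg_{B₀}(x,x') = deg_Y x' ≥ (p - 1/P)² a`, hence `codeg_B(x,x') ≥ (p - 1/P)² a - #Bad ≥ c`
(`B ⊇ B₀ ∖ Bad`), so it is not counted; finally `16 E ≤ P` and `m ≤ 16 a` give `E · #{…} ≤ a`.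
[folklore] -/
theorem codegree_few {m P a E c : ℕ} {X : Finset (Fin N × Fin N)}
    {V W A B₀ Bad B : Finset (Fin N)} {p : ℝ}
    (hreg : ∀ S ⊆ V, ∀ T ⊆ W, m ≤ P * S.card → m ≤ P * T.card →
      |((X.filter fun e => e.1 ∈ S ∧ e.2 ∈ T).card : ℝ) / ((S.card : ℝ) * (T.card : ℝ)) - p| ≤
        1 / (P : ℝ))
    (hm : 1 ≤ m) (hAV : A ⊆ V) (hB₀W : B₀ ⊆ W) (hsub : B₀ \ Bad ⊆ B)
    (h16a : m ≤ 16 * a) (hPE : 16 * E ≤ P) (hp0 : 0 ≤ p - 1 / (P : ℝ))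
    (hrow₀ : ∀ x ∈ A, (p - 1 / (P : ℝ)) * a ≤ ((B₀.filter fun y => (x, y) ∈ X).card : ℝ))
    (hY : ∀ x ∈ A, m ≤ P * (B₀.filter fun y => (x, y) ∈ X).card)
    (hc : (c : ℝ) + Bad.card ≤ (p - 1 / (P : ℝ)) * ((p - 1 / (P : ℝ)) * a)) :
    ∀ x ∈ A, E * (A.filter fun x' => x' ≠ x ∧
      (B.filter fun y => (x, y) ∈ X ∧ (x', y) ∈ X).card < c).card ≤ a := by
  intro x hx
  obtain ⟨Y, hYd⟩ : ∃ Y : Finset (Fin N), Y = B₀.filter fun y => (x, y) ∈ X := ⟨_, rfl⟩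
  have hYrow : (p - 1 / (P : ℝ)) * a ≤ (Y.card : ℝ) := by rw [hYd]; exact hrow₀ x hx
  have hYW : Y ⊆ W := by rw [hYd]; exact (filter_subset _ _).trans hB₀W
  have hYm : m ≤ P * Y.card := by rw [hYd]; exact hY x hx
  obtain ⟨L, hLd⟩ : ∃ L : Finset (Fin N), L = A.filter fun x' =>
      ((Y.filter fun y => (x', y) ∈ X).card : ℝ) < (p - 1 / (P : ℝ)) * Y.card := ⟨_, rfl⟩
  -- rows with few neighbours in `Y = N_{B₀}(x)` are few
  have hL : P * L.card < m := by
    rw [hLd]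
    exact few_lowRows hreg hm ((filter_subset _ _).trans hAV) hYW hYm
      fun x' hx' => (mem_filter.1 hx').2
  -- the (h3) rows are among them
  have hsubL : (A.filter fun x' => x' ≠ x ∧
      (B.filter fun y => (x, y) ∈ X ∧ (x', y) ∈ X).card < c) ⊆ L := by
    intro x' hx'
    rw [mem_filter] at hx'
    rw [hLd, mem_filter]
    refine ⟨hx'.1, ?_⟩
    by_contra hge
    rw [not_lt] at hge
    have h1 : (p - 1 / (P : ℝ)) * ((p - 1 / (P : ℝ)) * a) ≤
        ((Y.filter fun y => (x', y) ∈ X).card : ℝ) :=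
      (mul_le_mul_of_nonneg_left hYrow hp0).trans hge
    have h2 : (Y.filter fun y => (x', y) ∈ X) = B₀.filter fun y => (x, y) ∈ X ∧ (x', y) ∈ X := by
      rw [hYd, filter_filter]
    rw [h2] at h1
    have h3 : (((B₀.filter fun y => (x, y) ∈ X ∧ (x', y) ∈ X).card : ℕ) : ℝ) ≤
        ((B.filter fun y => (x, y) ∈ X ∧ (x', y) ∈ X).card : ℝ) + Bad.card := by
      exact_mod_cast card_filter_le_of_sdiff_subset hsub (fun y => (x, y) ∈ X ∧ (x', y) ∈ X)
    have h4 : (c : ℝ) ≤ ((B.filter fun y => (x, y) ∈ X ∧ (x', y) ∈ X).card : ℝ) := by linarith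
    exact absurd hx'.2.2 (not_lt.2 (by exact_mod_cast h4))
  have h1 : 16 * (E * L.card) ≤ P * L.card := by
    rw [← Nat.mul_assoc]; exact Nat.mul_le_mul_right _ hPE
  have h2 : E * (A.filter fun x' => x' ≠ x ∧
      (B.filter fun y => (x, y) ∈ X ∧ (x', y) ∈ X).card < c).card ≤ E * L.card :=
    Nat.mul_le_mul_left E (card_le_card hsubL)
  omega

/-- **stub_regularPairClean — cleaning a dense regular pair to minimum degrees, few low-codegree
partners and a perfect matching.**  For `Dd, E ≥ 1` take `P₀ := 2048 Dd² E`, `m₀ := 16`.  If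
`(V, W)` (`#V = #W = m ≥ m₀`) has density `p := e(V,W)/m² ≥ 1/Dd` and is `1/P`-regular
(`P ≥ P₀`), then with `a := m/8` there are `A ⊆ V`, `B ⊆ W`, `#A = #B = a`, `m ≤ 16a`, with (h1)
row and column degrees `≥ a/(4Dd)`, (h3) for each `x ∈ A` at most `a/E` rows `x' ≠ x` of `A` with
`codeg_B(x,x') < a/(64Dd²)`, (pm) an injection `g` of `A` into `B` along edges, (dens)
`a² ≤ 2Dd·e(A,B)`, (reg) `1/(P/16)`-regularity of `(A, B)` for its own density.  ROUTE: see the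
module docstring — `stub_regularPairClean_sets` (construction), `numerics` (parameters), `codegree_few`
(h3), `exists_matching` (Hall, via `Finset.all_card_le_biUnion_card_iff_exists_injective`),
`sq_le_of_min_degree` (dens), `regularity_transfer` (reg). [folklore] -/
theorem stub_regularPairClean :
    ∀ Dd E : ℕ, 1 ≤ Dd → 1 ≤ E → ∃ P₀ m₀ : ℕ, ∀ (N m P : ℕ) (X : Finset (Fin N × Fin N)) (V W : Finset (Fin N)),
      P₀ ≤ P → V.card = m → W.card = m → m₀ ≤ m →
      m * m ≤ Dd * (X.filter fun e => e.1 ∈ V ∧ e.2 ∈ W).card →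
      (∀ S ⊆ V, ∀ T ⊆ W, m ≤ P * S.card → m ≤ P * T.card →
        |(((X.filter fun e => e.1 ∈ S ∧ e.2 ∈ T).card : ℕ) : ℝ) / ((S.card : ℝ) * (T.card : ℝ)) -
          (((X.filter fun e => e.1 ∈ V ∧ e.2 ∈ W).card : ℕ) : ℝ) / ((m : ℝ) * (m : ℝ))| ≤ 1 / (P : ℝ)) →
      ∃ (a : ℕ) (A B : Finset (Fin N)) (g : Fin N → Fin N), A ⊆ V ∧ B ⊆ W ∧ A.card = a ∧ B.card = a ∧ 1 ≤ a ∧ m ≤ 16 * a ∧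
        (∀ x ∈ A, a ≤ 4 * Dd * (B.filter fun y => (x, y) ∈ X).card) ∧
        (∀ y ∈ B, a ≤ 4 * Dd * (A.filter fun x => (x, y) ∈ X).card) ∧
        (∀ x ∈ A, E * (A.filter fun x' => x' ≠ x ∧
            (B.filter fun y => (x, y) ∈ X ∧ (x', y) ∈ X).card < a / (64 * Dd ^ 2)).card ≤ a) ∧
        (∀ x ∈ A, g x ∈ B ∧ (x, g x) ∈ X) ∧ (∀ x ∈ A, ∀ x' ∈ A, g x = g x' → x = x') ∧
        a * a ≤ 2 * Dd * (X.filter fun e => e.1 ∈ A ∧ e.2 ∈ B).card ∧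
        (∀ S ⊆ A, ∀ T ⊆ B, a ≤ (P / 16) * S.card → a ≤ (P / 16) * T.card →
          |(((X.filter fun e => e.1 ∈ S ∧ e.2 ∈ T).card : ℕ) : ℝ) / ((S.card : ℝ) * (T.card : ℝ)) -
            (((X.filter fun e => e.1 ∈ A ∧ e.2 ∈ B).card : ℕ) : ℝ) / ((a : ℝ) * (a : ℝ))| ≤ 1 / ((P / 16 : ℕ) : ℝ)) := by
  intro Dd E hDd hE
  refine ⟨2048 * Dd ^ 2 * E, 16, ?_⟩
  intro N m P X V W hP hV hW hm hdens hreg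
  -- sizes
  obtain ⟨a, ha⟩ : ∃ a : ℕ, a = m / 8 := ⟨_, rfl⟩
  have h8a : 8 * a ≤ m := by omega
  have h16a : m ≤ 16 * a := by omega
  have ha1 : 1 ≤ a := by omega
  have hm1 : 1 ≤ m := by omega
  have hD2 : 1 ≤ Dd ^ 2 := Nat.one_le_pow 2 Dd hDd
  have hPE : 16 * E ≤ P := le_trans (Nat.mul_le_mul_right E (by omega : 16 ≤ 2048 * Dd ^ 2)) hP
  have hP16 : 16 ≤ P := le_trans (by omega : 16 ≤ 16 * E) hPE
  have hPa : m ≤ P * a := le_trans h16a (Nat.mul_le_mul_right a hP16)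
  -- the reference density and the parameters
  set p : ℝ := (((X.filter fun e => e.1 ∈ V ∧ e.2 ∈ W).card : ℕ) : ℝ) / ((m : ℝ) * (m : ℝ))
    with hp
  have hmpos : (0 : ℝ) < m := by exact_mod_cast hm1
  have hD1 : (1 : ℝ) ≤ Dd := by exact_mod_cast hDd
  have hPpos : (0 : ℝ) < P := by exact_mod_cast (show 0 < P by omega)
  have hpD : 1 / (Dd : ℝ) ≤ p := by
    rw [hp, div_le_div_iff₀ (by linarith) (mul_pos hmpos hmpos), one_mul]
    have h : ((m * m : ℕ) : ℝ) ≤ ((Dd * (X.filter fun e => e.1 ∈ V ∧ e.2 ∈ W).card : ℕ) : ℝ) := by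
      exact_mod_cast hdens
    push_cast at h
    linarith
  obtain ⟨hN2, hN4, h32⟩ := numerics hDd hE hP hpD
  have hPinv : (0 : ℝ) ≤ 1 / (P : ℝ) := by positivity
  have hp1 : 1 / (2 * (Dd : ℝ)) ≤ p - 1 / (P : ℝ) := by linarith
  have hδpos : (0 : ℝ) < 1 / (2 * (Dd : ℝ)) := div_pos one_pos (by linarith)
  have hp0 : 0 ≤ p - 1 / (P : ℝ) := hδpos.le.trans hp1
  -- `m ≤ P k` as soon as `k ≥ a/(2Dd)`, and the converse
  have hbig : ∀ k : ℕ, 1 / (2 * (Dd : ℝ)) * a ≤ (k : ℝ) → m ≤ P * k := by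
    intro k hk
    have h1 : (a : ℝ) ≤ 2 * Dd * k := by
      have := mul_le_mul_of_nonneg_left hk (by positivity : (0 : ℝ) ≤ 2 * Dd)
      rwa [← mul_assoc, mul_one_div_cancel (ne_of_gt (by linarith)), one_mul] at this
    have h2 : 32 * (Dd : ℝ) * k ≤ P * k := mul_le_mul_of_nonneg_right h32 (Nat.cast_nonneg k)
    have h3 : (m : ℝ) ≤ 16 * a := by exact_mod_cast h16a
    have h4 : (m : ℝ) ≤ P * k := by linarith
    exact_mod_cast h4
  have hsmall : ∀ k : ℕ, P * k < m → (k : ℝ) < 1 / (2 * (Dd : ℝ)) * a := by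
    intro k hk
    by_contra h
    exact absurd (hbig k (not_lt.1 h)) (not_le.2 hk)
  -- the construction
  obtain ⟨A, B₀, Bad, B, hAV, hA, hB₀W, hB₀, hBW, hB, hsub, hBad, hrow₀, hcol₀⟩ :=
    stub_regularPairClean_sets N m P a X V W p hreg hm1 hV hW h8a hPa hP16
  have hBadR : (Bad.card : ℝ) < 16 * a * (1 / (P : ℝ)) := by
    rw [← mul_div_assoc, mul_one, lt_div_iff₀ hPpos]
    have h : ((P * Bad.card : ℕ) : ℝ) < ((16 * a : ℕ) : ℝ) := by
      exact_mod_cast lt_of_lt_of_le hBad h16a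
    push_cast at h
    linarith
  -- degrees
  have hrow : ∀ x ∈ A, 1 / (2 * (Dd : ℝ)) * a ≤ ((B.filter fun y => (x, y) ∈ X).card : ℝ) := by
    intro x hx
    have h2 : (((B₀.filter fun y => (x, y) ∈ X).card : ℕ) : ℝ) ≤
        ((B.filter fun y => (x, y) ∈ X).card : ℝ) + Bad.card := by
      exact_mod_cast card_filter_le_of_sdiff_subset hsub (fun y => (x, y) ∈ X)
    have h3 := hrow₀ x hx
    have h4 : (1 / (2 * (Dd : ℝ)) + 17 * (1 / (P : ℝ))) * a ≤ p * a :=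
      mul_le_mul_of_nonneg_right hN2 (Nat.cast_nonneg a)
    linarith
  have hcol : ∀ y ∈ B, 1 / (2 * (Dd : ℝ)) * a ≤ ((A.filter fun x => (x, y) ∈ X).card : ℝ) :=
    fun y hy => (mul_le_mul_of_nonneg_right hp1 (Nat.cast_nonneg a)).trans (hcol₀ y hy)
  -- Hall's exceptional clause: a row set larger than `a/(2Dd)` misses few columns entirely
  have hexc : ∀ U ⊆ A, 1 / (2 * (Dd : ℝ)) * a < U.card →
      ((B.filter fun y => ∀ x ∈ U, (x, y) ∉ X).card : ℝ) < 1 / (2 * (Dd : ℝ)) * a := by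
    intro U hUA hU
    refine hsmall _ (few_lowCols hreg hm1 (hUA.trans hAV) ((filter_subset _ _).trans hBW)
      (hbig _ hU.le) fun y hy => ?_)
    have h0 : (U.filter fun x => (x, y) ∈ X) = ∅ := filter_eq_empty_iff.2 (mem_filter.1 hy).2
    rw [h0, card_empty, Nat.cast_zero]
    have hUpos : (0 : ℝ) < U.card := lt_of_le_of_lt (by positivity) hU
    exact mul_pos (hδpos.trans_le hp1) hUpos
  obtain ⟨g, hg, hginj⟩ := exists_matching hA hB hrow hcol hexc
  -- (h3) ingredients
  have hY : ∀ x ∈ A, m ≤ P * (B₀.filter fun y => (x, y) ∈ X).card := fun x hx =>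
    hbig _ ((mul_le_mul_of_nonneg_right hp1 (Nat.cast_nonneg a)).trans (hrow₀ x hx))
  have hc : ((a / (64 * Dd ^ 2) : ℕ) : ℝ) + Bad.card ≤
      (p - 1 / (P : ℝ)) * ((p - 1 / (P : ℝ)) * a) := by
    have h1 : ((a / (64 * Dd ^ 2) : ℕ) : ℝ) ≤ (a : ℝ) / ((64 * Dd ^ 2 : ℕ) : ℝ) := Nat.cast_div_le
    have h2 : (a : ℝ) / ((64 * Dd ^ 2 : ℕ) : ℝ) = 1 / (64 * (Dd : ℝ) ^ 2) * a := by
      push_cast; ring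
    have h3 : (1 / (64 * (Dd : ℝ) ^ 2) + 16 * (1 / (P : ℝ))) * a ≤
        (p - 1 / (P : ℝ)) * (p - 1 / (P : ℝ)) * a :=
      mul_le_mul_of_nonneg_right hN4 (Nat.cast_nonneg a)
    linarith
  exact ⟨a, A, B, g, hAV, hBW, hA, hB, ha1, h16a,
    fun x hx => le_four_mul_of_half_bound hDd (hrow x hx),
    fun y hy => le_four_mul_of_half_bound hDd (hcol y hy),
    codegree_few hreg hm1 hAV hB₀W hsub h16a hPE hp0 hrow₀ hY hc, hg, hginj,
    sq_le_of_min_degree hDd hA hrow, regularity_transfer hreg hAV hBW hA hB h16a hP16⟩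

end Summit.ValiantsHypothesis.ValiantsHypothesis.Theorems.DivisionGap.PerMultiplesHard.RegularPairClean
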